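import Summits.CriticalPhenomena.Ising3DConformalLimit.Theses.UnitLightCone
import Summits.CriticalPhenomena.Ising3DConformalLimit.Theorems.HyperoctahedralRPTwoPointKernelOfLimit

/-!
# `UnitSpeedTwoPoint` (crux stmt-CriticalPhenomena-17167, route `UnitLightCone`): the Källén–Lehmann measure is
# never finite — the natural strengthening "∃ a FINITE unit-cone spectral measure" is refuted (negative-side
# support, refuter cdisprove seat)

* `no_finite_unitCone_measure_of_powerLaw` — model-blind: a measure `μ` on `ℝ² × ℝ` carried by `{ω ≥ ‖k‖}` with
  `∫ e^{-ω|t|} dμ = C t^{-2Δ}` for all `t > 0` (`C, Δ > 0`) is not finite (`∫ e^{-ωt} dμ ≤ μ(univ)` versus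
  `C t^{-2Δ} → ∞` as `t → 0⁺`).
* `unitSpeedTwoPoint_measure_not_finite` — for every admissible limit `(ρ, Δ, S)` of the crux, EVERY measure
  realising its `e₂`-frame clause is infinite (the axis values are `t^{-2Δ} K(e₂)`, `K(e₂) > 0`, `Δ ≥ 1/2`, by the
  landed `HyperoctahedralRPTwoPoint.twoPointKernelOfLimit_proof`).

Moral for provers: the spectral measure to be produced is infinite but s-finite (it is `C₀ •` the cone pushforward
of `(2πΩ)⁻¹ d²k ⊗ ν`); no `IsFiniteMeasure` / `IsProbabilityMeasure` API applies, integrability of `e^{-ω|t|}`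
holds only for `t ≠ 0`.  This file does NOT refute the crux.
-/

noncomputable section

namespace Summit.CriticalPhenomena.Ising3DConformalLimit.Theorems.UnitSpeedTwoPoint.Negative

open MeasureTheory
open Literature.Probability.LatticeModels

/-- **No FINITE cone measure represents a power law on the axis.** If `μ` is carried by `{ω ≥ ‖k‖}` and
`∫ e^{-ω|t|} dμ = C t^{-2Δ}` for `t > 0` (`C, Δ > 0`), then `μ` has infinite mass: `∫ e^{-ωt} dμ ≤ μ(univ)` while
`C t^{-2Δ} → ∞` as `t → 0⁺`.  (So the strengthening of `UnitSpeedTwoPoint` asking for a finite / probability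
spectral measure is false for every admissible limit; provers must work with an infinite, s-finite `μ`.) [folklore] -/
theorem no_finite_unitCone_measure_of_powerLaw (μ : Measure (EuclideanSpace ℝ (Fin 2) × ℝ))
    (hμ : μ {p : EuclideanSpace ℝ (Fin 2) × ℝ | p.2 < ‖p.1‖} = 0) {C Δ : ℝ} (hC : 0 < C) (hΔ : 0 < Δ)
    (hrep : ∀ t : ℝ, 0 < t → C * t ^ (-(2 * Δ)) = ∫ p, Real.exp (-(p.2 * |t|)) ∂μ) :
    ¬ IsFiniteMeasure μ := by
  intro hfin
  have hae : ∀ᵐ p ∂μ, ‖p.1‖ ≤ p.2 := by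
    have h0 := measure_eq_zero_iff_ae_notMem.1 hμ
    filter_upwards [h0] with p hp
    simpa [Set.mem_setOf_eq, not_lt] using hp
  set M : ℝ := μ.real Set.univ with hM
  have hbound : ∀ t : ℝ, 0 < t → C * t ^ (-(2 * Δ)) ≤ M := by
    intro t ht
    have hval : 0 < C * t ^ (-(2 * Δ)) := mul_pos hC (Real.rpow_pos_of_pos ht _)
    have hint : Integrable (fun p : EuclideanSpace ℝ (Fin 2) × ℝ => Real.exp (-(p.2 * |t|))) μ := by
      by_contra hni
      have h := hrep t ht
      rw [integral_undef hni] at h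
      linarith
    rw [hrep t ht]
    calc ∫ p, Real.exp (-(p.2 * |t|)) ∂μ ≤ ∫ _p, (1 : ℝ) ∂μ := by
          apply integral_mono_ae hint (integrable_const 1)
          filter_upwards [hae] with p hp
          have hω : 0 ≤ p.2 := le_trans (norm_nonneg _) hp
          exact Real.exp_le_one_iff.2 (by nlinarith [abs_nonneg t])
      _ = M := by simp [hM]
  have hMC : 0 ≤ M / C := div_nonneg measureReal_nonneg hC.le
  set B : ℝ := M / C + 1 with hB
  have hBpos : 0 < B := by linarith
  set t : ℝ := B ^ (-(1 / (2 * Δ))) with ht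
  have htpos : 0 < t := Real.rpow_pos_of_pos hBpos _
  have hpow : t ^ (-(2 * Δ)) = B := by
    rw [ht, ← Real.rpow_mul hBpos.le]
    have : (-(1 / (2 * Δ))) * (-(2 * Δ)) = 1 := by field_simp
    rw [this, Real.rpow_one]
  have h := hbound t htpos
  rw [hpow, hB, mul_add, mul_div_cancel₀ _ hC.ne', mul_one] at h
  linarith

/-- The axis point `0 e₀ + 0 e₁ + t e₂` is `t • (0 e₀ + 0 e₁ + 1 e₂)`. [folklore] -/
theorem axisPoint_zero_zero (t : ℝ) :
    (EuclideanSpace.single 0 0 + EuclideanSpace.single 1 0 + EuclideanSpace.single 2 t :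
        EuclideanSpace ℝ (Fin 3)) =
      t • (EuclideanSpace.single 0 0 + EuclideanSpace.single 1 0 + EuclideanSpace.single 2 1 :
        EuclideanSpace ℝ (Fin 3)) := by
  ext i
  fin_cases i <;> simp

/-- **Crux-level corollary (uses the Ising input through the landed `twoPointKernelOfLimit_proof`): for every
admissible limit, EVERY measure realising the `e₂`-frame clause of `UnitSpeedTwoPoint` is infinite** — the
strengthened crux "∃ a finite unit-cone spectral measure" is false whenever the hypotheses are met.
[cite: GlimmJaffe1987, §6.2] -/
theorem unitSpeedTwoPoint_measure_not_finite {ρ : ℝ → ℝ} {Δ : ℝ} {S : CorrFamily 3}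
    (hρ : ∀ δ ∈ Set.Ioc (0:ℝ) 1, 0 < ρ δ) (hlim : HasPointwiseScalingLimit (criticalCorr 3) ρ S)
    (hnd : IsNondegenerateTwoPoint S) (htr : IsTranslationInvariant S) (hsc : IsScaleCovariant Δ S)
    (μ : Measure (EuclideanSpace ℝ (Fin 2) × ℝ)) (hμ : μ {p : EuclideanSpace ℝ (Fin 2) × ℝ | p.2 < ‖p.1‖} = 0)
    (hrep : ∀ t a b : ℝ, t ≠ 0 → (fun x : EuclideanSpace ℝ (Fin 3) => S 2 ![0, x])
      (EuclideanSpace.single 0 a + EuclideanSpace.single 1 b + EuclideanSpace.single 2 t) =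
        ∫ p, Real.cos (p.1 0 * a + p.1 1 * b) * Real.exp (-(p.2 * |t|)) ∂μ) :
    ¬ IsFiniteMeasure μ := by
  obtain ⟨⟨hΔ1, _⟩, _, hpos, hhom, _⟩ :=
    Summit.CriticalPhenomena.Ising3DConformalLimit.HyperoctahedralRPTwoPoint.twoPointKernelOfLimit_proof
      ρ Δ S hρ hlim hnd htr hsc
  set e : EuclideanSpace ℝ (Fin 3) :=
    EuclideanSpace.single 0 0 + EuclideanSpace.single 1 0 + EuclideanSpace.single 2 1 with he
  have he0 : e ≠ 0 := by
    intro h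
    have h2 : e 2 = (1 : ℝ) := by simp [he]
    rw [h] at h2
    simp at h2
  refine no_finite_unitCone_measure_of_powerLaw μ hμ (hpos e he0) (by linarith) fun t ht => ?_
  have h := hrep t 0 0 ht.ne'
  simp only [mul_zero, add_zero, Real.cos_zero, one_mul] at h
  rw [← h, axisPoint_zero_zero t, hhom t ht, mul_comm]

end Summit.CriticalPhenomena.Ising3DConformalLimit.Theorems.UnitSpeedTwoPoint.Negative

end
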